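import Summits.BirchSwinnertonDyer.BirchSwinnertonDyer.Theorems.AdditiveBranchIMCMultLowerCycLineGrossZagier
import Summits.BirchSwinnertonDyer.Rank1Residual.Additive.DisegniLineGrossZagierOdd
import HarnessLib

/-!
# Route `AdditiveBranchIMC` (rung K1), crux `MultLower` (item 19359), cell (M): the KERNEL (M) twin of
# gz's STEP C⁻(2) — the twisted-branch `p`-adic Gross–Zagier identity at a MULTIPLICATIVE twist model
# `(V, f, ϖ)` from Disegni's clauses, ODD branch (`p ≡ 3 (mod 4)`, minus symbols, `C • V^{(−p)} = W`)

Cell `bsd-addord`, seat `bsd-addord-k1-c4` (gen 4). THEOREMS ONLY (no definition, no named fact, no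
`sorry`). The (M) twin of gz's `DisegniLineGrossZagierOdd.lean` (`branchPAdicGrossZagier_identity_of_cycLine_odd`,
p416794): for `E = W` additive at `p ≡ 3 (mod 4)` of analytic rank one, `C • V^{(−p)} = W` with `V`
MULTIPLICATIVE at `p` (`a = a_p(V) = ±1`, newform `f`, `ϖ·|Ω⁻_V| = Ω⁻_f`), Heegner-field twist data as in the
even file, and `Dh`, `DhK` carrying `CycLineGrossZagierClauses W K ι f_E a DhK`:

  `∃ u ∈ ℤ_p^×, q ∈ ℚ:  L′(E,1) = q·Ω_E·Reg_∞(E)  ∧  ϖ·[T¹]L⁻_p(f, a, ω^{(p−1)/2}, T)·log_p γ = u·q·Reg_p(E,Dh)`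

(`branchPAdicGrossZagierMult_identity_of_cycLine_odd`). gz's `arch_algebra_odd` / `padic_algebra_odd` are
imported; the archimedean side is gz's `archRatioClause_rational_odd` with `GoodOrd V p` weakened to
`Good V p ∨ Mult V p` (`archRatioClause_rational_odd_semistable`: odd Birch `S′Ω⁻_{f′}i = τL₂(1)`,
`τ² = −p`, Pal for `d = −p` — the tree theorem `realPeriodRat_mul_sqrt_of_twist_of_neg`, `m₀ = |u(C)|·c_∞(E)`
a `p`-adic unit by `padicValRat_u_eq_zero_of_twist_pm_p` for `V` good OR multiplicative); the `p`-adic side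
`padicRatioClause_identity_mult_odd` has `Z° = −u·p·a⁻²`, unit `±m₀·a⁻¹`.

References: [Disegni2017] Thm. A/B, (1.1.3); [GrossZagier1986] Thm. I.(7.3); [Pal2012] Thm. 3.2 (d < 0);
[MazurTateTeitelbaum1986Invent] §I.8, §I.10 (10.1), §I.13–I.14; gz's memo HOME/proof/PROOF-gz-kernel.md §1⁻.
-/

set_option autoImplicit false
set_option linter.dupNamespace false

noncomputable section

open scoped Classical MatrixGroups ModularForm NumberField

namespace Summit.BirchSwinnertonDyer.BirchSwinnertonDyer.Theorems.AdditiveBranchIMCMultLower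

open CongruenceSubgroup WeierstrassCurve NumberField Literature.NumberTheory.EllipticCurves
  Literature.NumberTheory.EllipticCurves.ModularForms Literature.NumberTheory.EllipticCurves.Rank1Residual
  Literature.NumberTheory.EllipticCurves.Disegni2017 Literature.NumberTheory.QuadraticFields
  Literature.NumberTheory.GaloisRepresentations
  Summit.BirchSwinnertonDyer.Rank1Residual.Additive
  Summit.BirchSwinnertonDyer.Rank1Residual.AdditivePotMult

section IdentityOdd

variable {W : WeierstrassCurve ℚ} [W.IsElliptic] [W.IsGloballyMinimal] {p : ℕ} [hp : Fact p.Prime]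
  (ι : PadicAlgCl p ≃+* ℂ) (K : Type) [Field K] [NumberField K] [IsGalois ℚ K]

/-! ### §1 The odd one-term branch vanishes at `T = 0` in analytic rank one -/

/-- **In analytic rank one the odd one-term branch of the multiplicative twist vanishes at `T = 0`**
(`p ≡ 3 (mod 4)`, `C • V^{(−p)} = W`): the tree's `constantCoeff_multBranch_eq_zero_of_analyticRank_eq_one`
read at the odd parity and the sign `a_p`. [cite: MazurTateTeitelbaum1986Invent, §I.8, §I.13–I.14] -/
theorem constantCoeff_minusBranchMult_eq_zero_of_analyticRank_eq_one (hmod : hasEntireLFunction_rat)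
    (hadd : Addv W p) (hr : W.analyticRank = 1) (hp4 : p % 4 = 3)
    (V : WeierstrassCurve ℚ) [V.IsElliptic] [V.IsGloballyMinimal] (C : VariableChange ℚ)
    (hC : C • V.quadraticTwist (-(p : ℚ)) = W) (hV : Mult V p)
    {N : ℕ} [NeZero N] {f : CuspForm (Gamma0 N) 2} (hf : IsNewformOf V f)
    (ϖ : ℚ) (hϖ : (ϖ : ℝ) * V.imaginaryPeriodRat = minusPeriod f) :
    PowerSeries.constantCoeff (padicLFunctionMinusBranchMult f ((V.LFunction p : ℤ) : ℚ_[p]) (p / 2)) = 0 := by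
  have hp2 : p ≠ 2 := by omega
  have hodd : ¬ Even (p / 2) := by rw [Nat.not_even_iff_odd]; exact ⟨p / 4, by omega⟩
  have hC' : C • V.quadraticTwist ((-1 : ℚ) ^ (p / 2) * p) = W := by
    rw [pStar_eq_neg_of_mod_four_eq_three hp4]; exact hC
  have hϖ' : if Even (p / 2) then (ϖ : ℝ) * V.realPeriodRat = plusPeriod f
      else (ϖ : ℝ) * V.imaginaryPeriodRat = minusPeriod f := by rw [if_neg hodd]; exact hϖ
  by_cases hs : V.HasSplitMultiplicativeReductionAtPrime p
  · have ha : ((V.LFunction p : ℤ) : ℚ_[p]) = 1 := by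
      have h1 := (hf.cuspCoeff_eq_one_and_sq_of_split hs).1
      rw [hf.2 p] at h1
      have h1' : (V.LFunction p : ℤ) = 1 := by exact_mod_cast h1
      rw [h1']; push_cast; rfl
    have h := constantCoeff_multBranch_eq_zero_of_analyticRank_eq_one W p hmod hadd hr hp2 V C hC' hf
      _ (Or.inl ⟨hs, rfl⟩) ϖ hϖ'
    rw [if_neg hodd] at h
    rw [ha]; exact h
  · have ha : ((V.LFunction p : ℤ) : ℚ_[p]) = -1 := by
      have h1 := (hf.cuspCoeff_eq_neg_one_and_dvd_of_nonsplit hV hs).1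
      rw [hf.2 p] at h1
      have h1' : (V.LFunction p : ℤ) = -1 := by exact_mod_cast h1
      rw [h1']; push_cast; rfl
    have h := constantCoeff_multBranch_eq_zero_of_analyticRank_eq_one W p hmod hadd hr hp2 V C hC' hf
      _ (Or.inr ⟨hV, hs, rfl⟩) ϖ hϖ'
    rw [if_neg hodd] at h
    rw [ha]; exact h

/-! ### §2 STEP C⁻(2a): the archimedean side, odd branch, semistable `V` -/

/-- **STEP C⁻(2a) — the archimedean side, odd branch, `V` good OR multiplicative at `p`** (gz's
`archRatioClause_rational_odd` verbatim with `GoodOrd V p` weakened to `Good V p ∨ Mult V p`): `ρ ≠ 0` and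
`−u·Car·Ω⁻_f·Ω⁻_{f′} = ε·2uϖρp/(qcm₀S′)` for a sign `ε` and the `p`-adic unit `m₀ = |u(C)|·c_∞(E) ∈ ℚ`.
[cite: Disegni2017, (1.1.3)–(1.1.4) (arXiv v3 PDF pp. 4–5)] [cite: Pal2012, Thm. 3.2]
[cite: MazurTateTeitelbaum1986Invent, §I.8 (8.6)] -/
theorem archRatioClause_rational_odd_semistable (hp4 : p % 4 = 3)
    (hArt : rankinSelbergEulerProductHecke_baseChangeDirichlet_eq) (hmod : hasEntireLFunction_rat)
    (h2 : Module.finrank ℚ K = 2) (κ : DirichletCharacter ℂ (NumberField.discr K).natAbs)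
    (hκ : ∀ ℓ : ℕ, ℓ.Prime → ℓ ≠ 2 → κ ℓ = (jacobiSym (NumberField.discr K) ℓ : ℂ))
    (hκ2 : κ 2 = if NumberField.discr K % 8 = 1 then 1
        else if NumberField.discr K % 8 = 5 then -1 else 0)
    (hadd : Addv W p) (hr : W.analyticRank = 1)
    (V V' : WeierstrassCurve ℚ) [V.IsElliptic] [V.IsGloballyMinimal] [V'.IsElliptic] [V'.IsGloballyMinimal]
    (C : VariableChange ℚ) (hC : C • V.quadraticTwist (-(p : ℚ)) = W) (hsemi : Good V p ∨ Mult V p)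
    {N NE N' : ℕ} [NeZero N] [NeZero NE] [NeZero N'] {f : CuspForm (Gamma0 N) 2}
    {fE : CuspForm (Gamma0 NE) 2} {f' : CuspForm (Gamma0 N') 2}
    (hfV : IsNewformOf V f) (hfE : IsNewformOf W fE) (hfV' : IsNewformOf V' f')
    (hV' : ∀ n : ℕ, cuspCoeff f' n = κ (n : ZMod (NumberField.discr K).natAbs) * cuspCoeff f n)
    (hS' : legendreMinusSymbolSum f' p ≠ 0)
    (ϖ : ℚ) (hϖ : (ϖ : ℝ) * V.imaginaryPeriodRat = minusPeriod f)
    {c : ℚ} (hc : c ≠ 0)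
    (hcL : deriv W.entireLFunction 1 = (((c : ℝ) * W.realPeriodRat * W.regulator : ℝ) : ℂ))
    {Car : ℝ} (hCar : 0 < Car) {P₁ P₂ : (W.baseChange K).toAffine.Point} {q ρ : ℚ} (hq : q ≠ 0)
    (hArch : ArchRatioClause W K fE Car P₁ P₂ q)
    (hρR : (P₁.heightPairing P₂ : ℝ) = (ρ : ℝ) * (2 : ℕ) * W.regulator) :
    ρ ≠ 0 ∧ ∃ ε m₀ : ℚ, (ε = 1 ∨ ε = -1) ∧ m₀ ≠ 0 ∧ padicValRat p m₀ = 0 ∧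
      -(splitLocalConstant p : ℂ) * (Car : ℂ) * (minusPeriod f : ℂ) * (minusPeriod f' : ℂ) =
        ((ε * (2 * splitLocalConstant p * ϖ * ρ * p / (q * c * m₀ * legendreMinusSymbolSum f' p)) : ℚ) :
          ℂ) := by
  haveI : NeZero p := ⟨hp.out.ne_zero⟩
  haveI : NeZero (NumberField.discr K).natAbs :=
    ⟨Int.natAbs_ne_zero.mpr (NumberField.discr_ne_zero K)⟩
  have hpP : p.Prime := hp.out
  have hp2 : p ≠ 2 := by omega
  have hEnt : W.HasEntireLFunction := hmod W
  have hE : ∀ n : ℕ, cuspCoeff fE n = (legendreSym p (n : ℤ) : ℂ) * cuspCoeff f n := by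
    intro n
    rw [hfE.2 n, intCast_LFunction_eq_jacobiChar_mul_cuspCoeff_of_neg p hp4 V W ⟨C, hC⟩ hadd hfV n,
      jacobiChar_natCast, ← jacobiSym.legendreSym.to_jacobiSym]
  obtain ⟨hχ1, hχq, hχprim⟩ := jacobiChar_prime_ne_one_isQuadratic_isPrimitive p hp2
  have hχo := jacobiChar_odd_of_mod_four_eq_three p hp4
  set χ := jacobiChar p with hχdef
  obtain ⟨L₂, hL₂d, hL₂⟩ := exists_differentiable_eq_twistedLSeries_holds f' χ
  have hΛeq : ∀ s : ℂ, 2 < s.re →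
      W.entireLFunction s * L₂ s = rankinSelbergEulerProductHecke fE (1 : HeckeCharacter K) s := by
    intro s hs
    rw [hArt.trivial K h2 κ hκ hκ2 fE hfE.1 hs, W.entireLFunction_eq_LSeries hEnt (by linarith),
      hL₂ s hs]
    congr 1
    · rw [LSeries_eq_twistedLSeries_of_coeff W fE (1 : DirichletCharacter ℂ 1) (fun n ↦ by
        rw [MulChar.one_apply (isUnit_of_subsingleton _), one_mul, hfE.2 n])]
    · unfold twistedLSeries
      refine LSeries_congr (fun {n} _ ↦ ?_) s
      rw [dirichletCharacter_mul_natCast, MulChar.one_apply (isUnit_of_subsingleton _), one_mul,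
        hV' n, hE n, hχdef, jacobiChar_natCast, ← jacobiSym.legendreSym.to_jacobiSym]
      ring
  have hΛd : Differentiable ℂ (fun s ↦ W.entireLFunction s * L₂ s) :=
    (W.differentiable_entireLFunction hEnt).mul hL₂d
  have hA := hArch (fun s ↦ W.entireLFunction s * L₂ s) hΛd hΛeq
  have hL0 : W.entireLFunction 1 = 0 := entireLFunction_one_eq_zero_of_analyticRank_eq_one hr
  have hderiv : deriv (fun s ↦ W.entireLFunction s * L₂ s) 1 = deriv W.entireLFunction 1 * L₂ 1 := by
    rw [deriv_fun_mul (W.differentiable_entireLFunction hEnt 1) (hL₂d 1), hL0, zero_mul, add_zero]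
  rw [hderiv, hcL] at hA
  have hBirch := ratMinusTwistedSymbolSum_mul_minusPeriod_mul_I f' hfV'.1 hfV'.coeffField_eq_bot hχprim hχo
    hL₂d (fun s hs ↦ by rw [hχq.inv]; exact hL₂ s hs)
  rw [← cast_legendreMinusSymbolSum_eq_ratMinusTwistedSymbolSum p f'] at hBirch
  set τ : ℂ := gaussSum χ (ZMod.stdAddChar (N := p)) with hτdef
  have hτsq : τ ^ 2 = -(p : ℂ) := by
    rw [hτdef, gaussSum_sq hχ1 hχq (ZMod.isPrimitive_stdAddChar p), hχo, ZMod.card]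
    ring
  set sq : ℝ := Real.sqrt p with hsq
  have hsqC : ((sq : ℝ) : ℂ) ^ 2 = (p : ℂ) := by
    rw [← Complex.ofReal_pow, hsq, Real.sq_sqrt (Nat.cast_nonneg p)]
    push_cast
    rfl
  obtain ⟨ε, hε, hτp⟩ : ∃ ε : ℚ, (ε = 1 ∨ ε = -1) ∧
      Complex.I * τ * (sq : ℂ) = (ε : ℂ) * (p : ℂ) := by
    have h0 : (τ + Complex.I * (sq : ℂ)) * (τ - Complex.I * (sq : ℂ)) = 0 := by
      have hI : (Complex.I * (sq : ℂ)) ^ 2 = -(p : ℂ) := by rw [mul_pow, Complex.I_sq, hsqC]; ring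
      rw [← sq_sub_sq, hτsq, hI, sub_self]
    rcases mul_eq_zero.mp h0 with h | h
    · refine ⟨1, Or.inl rfl, ?_⟩
      rw [eq_neg_of_add_eq_zero_left h]
      push_cast
      linear_combination (-((sq : ℝ) : ℂ) ^ 2) * Complex.I_mul_I + hsqC
    · refine ⟨-1, Or.inr rfl, ?_⟩
      rw [sub_eq_zero.mp h]
      push_cast
      linear_combination (((sq : ℝ) : ℂ) ^ 2) * Complex.I_mul_I - hsqC
  have hpal := V.realPeriodRat_mul_sqrt_of_twist_of_neg (d := -(p : ℚ))
    (neg_lt_zero.mpr (by exact_mod_cast hpP.pos)) W C hC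
  have hsq' : Real.sqrt (-((-(p : ℚ) : ℚ) : ℝ)) = sq := by push_cast; rw [neg_neg]
  rw [hsq'] at hpal
  set cinf : ℕ := (W.baseChange ℝ).numRealComponents with hcinf
  set m₀ : ℚ := |(C.u : ℚ)| * (cinf : ℚ) with hm₀
  have hua0 : |(C.u : ℚ)| ≠ 0 := abs_ne_zero.mpr C.u.ne_zero
  have hcinf0 : (cinf : ℚ) ≠ 0 := by
    rw [hcinf, numRealComponents]
    split_ifs <;> norm_num
  have hm₀0 : m₀ ≠ 0 := mul_ne_zero hua0 hcinf0
  have hvm₀ : padicValRat p m₀ = 0 := by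
    have hu : padicValRat p (C.u : ℚ) = 0 :=
      padicValRat_u_eq_zero_of_twist_pm_p p hp2 V W hsemi (d := -(p : ℤ)) (Or.inr rfl) C
        (by push_cast; exact hC)
    have hvua : padicValRat p |(C.u : ℚ)| = 0 := by
      rcases abs_choice (C.u : ℚ) with h | h
      · rw [h, hu]
      · rw [h, padicValRat.neg, hu]
    rw [hm₀, padicValRat.mul hua0 hcinf0, hvua, hcinf, padicValRat_numRealComponents_eq_zero W p hp2,
      add_zero]
  have hm₀R : ((m₀ : ℚ) : ℝ) = |((C.u : ℚ) : ℝ)| * (cinf : ℝ) := by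
    simp only [hm₀, Rat.cast_mul, Rat.cast_abs, Rat.cast_natCast]
  have hm₀r0 : ((m₀ : ℚ) : ℝ) ≠ 0 := by exact_mod_cast hm₀0
  have hΩVr : V.imaginaryPeriodRat = W.realPeriodRat * sq / ((m₀ : ℚ) : ℝ) := by
    rw [eq_div_iff hm₀r0, hm₀R]
    linear_combination (-1 : ℝ) * hpal
  have hΩV : ((V.imaginaryPeriodRat : ℝ) : ℂ) = (W.realPeriodRat : ℂ) * (sq : ℂ) / ((m₀ : ℚ) : ℂ) := by
    rw [hΩVr]
    push_cast
    ring
  have hΩf : ((minusPeriod f : ℝ) : ℂ) = (ϖ : ℂ) * (V.imaginaryPeriodRat : ℝ) := by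
    rw [← hϖ]
    push_cast
    ring
  have hΩW : ((W.realPeriodRat : ℝ) : ℂ) ≠ 0 := by exact_mod_cast W.realPeriodRat_pos_holds.ne'
  have hΩf' : ((minusPeriod f' : ℝ) : ℂ) ≠ 0 := by
    exact_mod_cast (IsNewform0.minusPeriod_pos_holds hfV'.1 hfV'.coeffField_eq_bot).ne'
  have hR : ((W.regulator : ℝ) : ℂ) ≠ 0 := by exact_mod_cast (W.regulator_pos_holds).ne'
  have hS'c : ((legendreMinusSymbolSum f' p : ℚ) : ℂ) ≠ 0 := by exact_mod_cast hS'
  have hqc : (q : ℂ) ≠ 0 := by exact_mod_cast hq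
  have hcc : (c : ℂ) ≠ 0 := by exact_mod_cast hc
  have hCarc : ((Car : ℝ) : ℂ) ≠ 0 := by exact_mod_cast hCar.ne'
  have hm₀c : ((m₀ : ℚ) : ℂ) ≠ 0 := by exact_mod_cast hm₀0
  have hρR' : ((P₁.heightPairing P₂ / 2 : ℝ) : ℂ) = (ρ : ℂ) * (W.regulator : ℂ) := by
    rw [hρR]; push_cast; ring
  rw [hρR'] at hA
  push_cast at hA
  obtain ⟨hρ, hX⟩ := arch_algebra_odd (u := splitLocalConstant p) hA hBirch hτp hΩf hΩV hR hΩW hqc hcc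
    hS'c hCarc hΩf' hm₀c
  exact ⟨hρ, ε, m₀, hε, hm₀0, hvm₀, hX⟩

/-! ### §3 STEP C⁻(2b): the `p`-adic side for `α = a_p(V) = ±1`, odd branch -/

omit [W.IsElliptic] [W.IsGloballyMinimal] [IsGalois ℚ K] in
/-- **STEP C⁻(2b) — the `p`-adic side at a MULTIPLICATIVE twist model, odd branch:** `Z° = −u·p·a⁻²`
(`p* = −p`), `L⁻_p(f′,a,…)(0) = a⁻¹S′`, so `ϖ·[T¹]L⁻_p(f,a,ω^{(p−1)/2},T)·log_p γ = u′·c·Reg_p` with the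
unit `u′ = ±m₀·a⁻¹` (gz's `padic_algebra_odd`, verbatim).
[cite: Disegni2017, Theorem B (arXiv v3 PDF p. 9)] [cite: MazurTateTeitelbaum1986Invent, §I.10 (10.1), §I.14] -/
theorem padicRatioClause_identity_mult_odd (hp4 : p % 4 = 3) (V : WeierstrassCurve ℚ) [V.IsElliptic]
    [V.IsGloballyMinimal] (hV : Mult V p) {N : ℕ} [NeZero N] {f : CuspForm (Gamma0 N) 2}
    (hfV : IsNewformOf V f)
    {G : PowerSeries ℂ_[p]} {DhK : PAdicHeightDataK W p K} {Dh : PAdicHeightData W p}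
    {P₁ P₂ : (W.baseChange K).toAffine.Point} {q ρ c S' ϖ ε m₀ : ℚ} {σ₀ : ℤˣ} {X B₂ : ℂ_[p]}
    (hq : q ≠ 0) (hρ : ρ ≠ 0) (hc : c ≠ 0) (hS' : S' ≠ 0) (hε : ε = 1 ∨ ε = -1) (hm₀ : m₀ ≠ 0)
    (hvm₀ : padicValRat p m₀ = 0)
    (hPad : PAdicRatioClause W K ((V.LFunction p : ℤ) : ℚ_[p]) G DhK P₁ P₂ q σ₀)
    (hρp : DhK.pairing P₁ P₂ = (ρ : ℚ_[p]) * ((1 : ℕ) : ℚ_[p]) * padicRegulator Dh)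
    (hcoef : PowerSeries.coeff 1 G = X *
      algebraMap ℚ_[p] ℂ_[p] (PowerSeries.coeff 1
        (padicLFunctionMinusBranchMult f ((V.LFunction p : ℤ) : ℚ_[p]) (p / 2))) * B₂)
    (hB2 : B₂ = algebraMap ℚ_[p] ℂ_[p] ((((V.LFunction p : ℤ) : ℚ_[p]))⁻¹ * (S' : ℚ_[p])))
    (hX : X = algebraMap ℚ_[p] ℂ_[p]
      ((ε * (2 * splitLocalConstant p * ϖ * ρ * p / (q * c * m₀ * S')) : ℚ) : ℚ_[p])) :
    ∃ u : ℤ_[p]ˣ, (ϖ : ℚ_[p]) *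
        PowerSeries.coeff 1 (padicLFunctionMinusBranchMult f ((V.LFunction p : ℤ) : ℚ_[p]) (p / 2)) *
        padicLog p (cyclotomicGenerator p) = ((u : ℤ_[p]) : ℚ_[p]) * (c : ℚ_[p]) * padicRegulator Dh := by
  have hpP : p.Prime := hp.out
  set α : ℚ_[p] := ((V.LFunction p : ℤ) : ℚ_[p]) with hαdef
  set B₁ := padicLFunctionMinusBranchMult f α (p / 2) with hB₁
  set ℓγ : ℚ_[p] := padicLog p (cyclotomicGenerator p) with hℓγ
  rw [padicRatioClause_iff, hρp, hcoef, hB2, hX, Nat.cast_one, mul_one] at hPad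
  have hPad' : (ρ : ℚ_[p]) * padicRegulator Dh =
      ((σ₀ : ℤ) : ℚ_[p]) * (q : ℚ_[p]) * ((zCircOne p α)⁻¹ * 2⁻¹ * ℓγ) *
        ((((ε * (2 * splitLocalConstant p * ϖ * ρ * p / (q * c * m₀ * S'))) : ℚ) : ℚ_[p]) *
          PowerSeries.coeff 1 B₁ * (α⁻¹ * (S' : ℚ_[p]))) := by
    apply (algebraMap ℚ_[p] ℂ_[p]).injective
    simp only [map_mul, map_ratCast, map_intCast, map_inv₀, map_ofNat] at hPad ⊢
    linear_combination hPad
  obtain ⟨-, -, -, hα0⟩ := multRoot_spec V hV hfV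
  obtain ⟨u₀, hu₀⟩ := exists_unit_coe_eq_inv_multRoot V hV hfV
  have hpstar : (pStar p : ℚ_[p]) = -(p : ℚ_[p]) := by
    rw [pStar, show (p - 1) / 2 = p / 2 by omega, neg_one_pow_half_eq_neg_one_of_mod_four_eq_three p hp4]
    push_cast; ring
  have hu0 : (splitLocalConstant p : ℚ_[p]) ≠ 0 := by exact_mod_cast splitLocalConstant_ne_zero p
  have hpp : (p : ℚ_[p]) ≠ 0 := by exact_mod_cast hpP.ne_zero
  have hqp : (q : ℚ_[p]) ≠ 0 := by exact_mod_cast hq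
  have hcp' : (c : ℚ_[p]) ≠ 0 := by exact_mod_cast hc
  have hS'p : (S' : ℚ_[p]) ≠ 0 := by exact_mod_cast hS'
  have hρp' : (ρ : ℚ_[p]) ≠ 0 := by exact_mod_cast hρ
  have hm₀p : (m₀ : ℚ_[p]) ≠ 0 := by exact_mod_cast hm₀
  have hσ₀ : ((σ₀ : ℤ) : ℚ_[p]) = 1 ∨ ((σ₀ : ℤ) : ℚ_[p]) = -1 := by
    rcases Int.units_eq_one_or σ₀ with h | h <;> simp [h]
  have hεp : (ε : ℚ_[p]) = 1 ∨ (ε : ℚ_[p]) = -1 := by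
    rcases hε with h | h <;> simp [h]
  have hs2 : (((σ₀ : ℤ) : ℚ_[p]) * (ε : ℚ_[p])) ^ 2 = 1 := by
    rcases hσ₀ with h | h <;> rcases hεp with h' | h' <;> rw [h, h'] <;> norm_num
  rw [zCircOne] at hPad'
  have key := padic_algebra_odd hPad' hpstar hs2 hρp' hqp hcp' hS'p hu0 hα0 hpp hm₀p
  have hnorm : ‖((m₀ : ℚ) : ℚ_[p])‖ = 1 := by
    rw [Padic.norm_eq_zpow_neg_valuation hm₀p, Padic.valuation_ratCast, hvm₀, neg_zero, zpow_zero]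
  obtain ⟨w, hw⟩ := exists_unit_coe_eq_of_norm_eq_one p hnorm
  have hsign : ((σ₀ : ℤ) : ℚ_[p]) * (ε : ℚ_[p]) = 1 ∨ ((σ₀ : ℤ) : ℚ_[p]) * (ε : ℚ_[p]) = -1 := by
    rcases hσ₀ with h | h <;> rcases hεp with h' | h' <;> rw [h, h'] <;> norm_num
  rcases hsign with hs | hs
  · refine ⟨-(w * u₀), ?_⟩
    rw [key, hs, Units.val_neg, PadicInt.coe_neg, Units.val_mul, PadicInt.coe_mul, hw, hu₀]
    ring
  · refine ⟨w * u₀, ?_⟩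
    rw [key, hs, Units.val_mul, PadicInt.coe_mul, hw, hu₀]
    ring

/-! ### §4 STEP C⁻(2): the identity at `(V, f, ϖ)`, `V` MULTIPLICATIVE at `p`, odd branch -/

/-- **STEP C⁻(2), (M) twin — the twisted-branch `p`-adic Gross–Zagier identity at a MULTIPLICATIVE twist
model `(V, f, ϖ)` from Disegni's clauses, ODD branch `p ≡ 3 (mod 4)`.** See the module docstring.
[cite: Disegni2017, Theorem A (arXiv v3 PDF pp. 7–8), Theorem B (PDF p. 9), (1.1.3) (PDF pp. 4–5)]
[cite: GrossZagier1986, Thm. I.(7.3)] [cite: Pal2012, Thm. 3.2] [cite: MazurTateTeitelbaum1986Invent, §I.8 (8.6), §I.10 (10.1), §I.14] -/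
theorem branchPAdicGrossZagierMult_identity_of_cycLine_odd (hp4 : p % 4 = 3)
    (hArt : rankinSelbergEulerProductHecke_baseChangeDirichlet_eq) (h73 : GrossZagier1986_thm_I_7_3)
    (hmod : hasEntireLFunction_rat) (hGZK : rank_eq_analyticRank_of_analyticRank_le_one)
    (h2 : Module.finrank ℚ K = 2) (κ : DirichletCharacter ℂ (NumberField.discr K).natAbs)
    (hκ : ∀ ℓ : ℕ, ℓ.Prime → ℓ ≠ 2 → κ ℓ = (jacobiSym (NumberField.discr K) ℓ : ℂ))
    (hκ2 : κ 2 = if NumberField.discr K % 8 = 1 then 1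
        else if NumberField.discr K % 8 = 5 then -1 else 0)
    (hpd : Nat.Coprime p (NumberField.discr K).natAbs)
    (hrd : (W.quadraticTwist (NumberField.discr K : ℚ)).mordellWeilRank = 0)
    (hadd : Addv W p) (hr : W.analyticRank = 1)
    (V V' : WeierstrassCurve ℚ) [V.IsElliptic] [V.IsGloballyMinimal] [V'.IsElliptic] [V'.IsGloballyMinimal]
    (C : VariableChange ℚ) (hC : C • V.quadraticTwist (-(p : ℚ)) = W) (hV : Mult V p) (hV'm : Mult V' p)
    (hap : V'.LFunction p = V.LFunction p)
    {N NE N' : ℕ} [NeZero N] [NeZero NE] [NeZero N'] {f : CuspForm (Gamma0 N) 2}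
    {fE : CuspForm (Gamma0 NE) 2} {f' : CuspForm (Gamma0 N') 2}
    (hfV : IsNewformOf V f) (hfE : IsNewformOf W fE) (hfV' : IsNewformOf V' f')
    (hV' : ∀ n : ℕ, cuspCoeff f' n = κ (n : ZMod (NumberField.discr K).natAbs) * cuspCoeff f n)
    (hS' : legendreMinusSymbolSum f' p ≠ 0)
    (ϖ : ℚ) (hϖ : (ϖ : ℝ) * V.imaginaryPeriodRat = minusPeriod f)
    {Dh : PAdicHeightData W p} {DhK : PAdicHeightDataK W p K} (hres : DhK.RestrictsToWith Dh 1)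
    (hGZc : CycLineGrossZagierClauses W K ι fE ((V.LFunction p : ℤ) : ℚ_[p]) DhK) :
    ∃ (u : ℤ_[p]ˣ) (q : ℚ),
      W.leadingLCoeff = (q : ℂ) * (W.realPeriodRat : ℂ) * (W.regulator : ℂ) ∧
      (ϖ : ℚ_[p]) *
          PowerSeries.coeff 1 (padicLFunctionMinusBranchMult f ((V.LFunction p : ℤ) : ℚ_[p]) (p / 2)) *
          padicLog p (cyclotomicGenerator p) =
        ((u : ℤ_[p]) : ℚ_[p]) * (q : ℚ_[p]) * padicRegulator Dh := by
  haveI : NeZero p := ⟨hp.out.ne_zero⟩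
  have hp2 : p ≠ 2 := by omega
  have hVW : ∃ C : VariableChange ℚ, C • V.quadraticTwist (-(p : ℚ)) = W := ⟨C, hC⟩
  obtain ⟨Car, hCar, G, hG, P₁, P₂, q, σ₀, hq, hArch, hPad⟩ := hGZc
  have hE : ∀ n : ℕ, cuspCoeff fE n = (legendreSym p (n : ℤ) : ℂ) * cuspCoeff f n := by
    intro n
    rw [hfE.2 n, intCast_LFunction_eq_jacobiChar_mul_cuspCoeff_of_neg p hp4 V W hVW hadd hfV n,
      jacobiChar_natCast, ← jacobiSym.legendreSym.to_jacobiSym]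
  have hB0 : PowerSeries.constantCoeff
      (padicLFunctionMinusBranchMult f ((V.LFunction p : ℤ) : ℚ_[p]) (p / 2)) = 0 :=
    constantCoeff_minusBranchMult_eq_zero_of_analyticRank_eq_one hmod hadd hr hp4 V C hC hV hfV ϖ hϖ
  have hcoef := coeff_one_cycLine_eq_mult_odd ι K hp4 hArt h2 κ hκ hκ2 hpd V V' hV hV'm hap hfV hfE.1 hfV'
    hE hV' hG hB0
  have hB2 : algebraMap ℚ_[p] ℂ_[p]
      (PowerSeries.constantCoeff
        (padicLFunctionMinusBranchMult f' ((V'.LFunction p : ℤ) : ℚ_[p]) (p / 2))) =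
      algebraMap ℚ_[p] ℂ_[p] ((((V.LFunction p : ℤ) : ℚ_[p]))⁻¹ *
        (legendreMinusSymbolSum f' p : ℚ_[p])) := by
    rw [constantCoeff_padicLFunctionMinusBranchMult_half_of_mult hp2 V' hV'm hfV', hap]
  have hrk : W.mordellWeilRank = 1 := by rw [(hGZK W (by rw [hr])).1, hr]
  obtain ⟨ρ, hρR, hρp⟩ := exists_rat_heightPairing_eq_and_pairing_eq K h2 hrk hrd hres P₁ P₂
  rw [h2] at hρR
  obtain ⟨hlead, -⟩ := leadingLCoeff_eq_deriv_of_analyticRank_eq_one hr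
  obtain ⟨c, hc, hcL⟩ := leadingLCoeff_eq_rat_mul_of_analyticRank_eq_one h73 hr hrk
  rw [hlead] at hcL
  obtain ⟨hρ, ε, m₀, hε, hm₀0, hvm₀, hX⟩ := archRatioClause_rational_odd_semistable K hp4 hArt hmod h2 κ
    hκ hκ2 hadd hr V V' C hC (Or.inr hV) hfV hfE hfV' hV' hS' ϖ hϖ hc hcL hCar hq hArch hρR
  have hXp : ((ι.symm (-(splitLocalConstant p : ℂ) * (Car : ℂ) * (minusPeriod f : ℂ) *
      (minusPeriod f' : ℂ)) : PadicAlgCl p) : ℂ_[p]) = algebraMap ℚ_[p] ℂ_[p]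
      ((ε * (2 * splitLocalConstant p * ϖ * ρ * p / (q * c * m₀ * legendreMinusSymbolSum f' p)) : ℚ) :
        ℚ_[p]) := by
    rw [hX, coe_symm_ratCast, map_ratCast]
  obtain ⟨u, hu⟩ := padicRatioClause_identity_mult_odd K hp4 V hV hfV hq hρ hc hS' hε hm₀0 hvm₀ hPad
    hρp hcoef hB2 hXp
  exact ⟨u, c, by rw [hlead, hcL]; push_cast; ring, hu⟩

end IdentityOdd

end Summit.BirchSwinnertonDyer.BirchSwinnertonDyer.Theorems.AdditiveBranchIMCMultLower

end
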